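import Summits.Ventures.YMGap.Thresholds.ZeroCouplingOnePlaquetteKernel
import Summits.Ventures.YMGap.Thresholds.StrongCouplingAnalytic
import Literature.MathematicalPhysics.QuantumFieldTheory.LatticeGaugeShenZhuZhuProofs
import Literature.Probability.LatticeModels.GibbsStrongMarkov
import HarnessLib

/-!
# The ONE-PLAQUETTE LAW: in every DLR state of every compact gauge group, a single-plaquette observable equals its
# one-plaquette Gibbs mean up to `O(β⁴)`, uniformly over all DLR states (row type C-SLOPE-0-G, part 4b)

Cell `pub-ymgap`, seat ds-1 (gen 15). HONEST FRAMING: exact LATTICE statement at the strong-coupling end point `β = 0` of the Wilson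
action `β Σ_p (N − Re tr ρ(U_p))` on `ℤ^d`, for an ARBITRARY compact metrisable gauge group `G`, continuous `ρ`, every `d`, both signs of
`β`: the first THREE strong-coupling orders of every single-plaquette expectation are those of ONE tilted Haar integral, with an `O(β⁴)`
remainder UNIFORM OVER ALL DLR STATES (no uniqueness, no window, no cluster expansion). Generality/exactness, not a threshold; nothing
about weak coupling, the continuum, or Clay. Kernel theorems, 0 defs, 0 compute.

## Contents

Write `⟨φ⟩₁(β) := ∫ φ e^{−β(N − Re tr ρ)} dHaar / ∫ e^{−β(N − Re tr ρ)} dHaar` (the one-plaquette tilted Haar mean — the two-dimensional /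
"mean-field" value).
* ★★ `abs_integral_tilted_sub_onePlaquette_le` — the KERNEL estimate: for every boundary condition `η` and `|β| ≤ 1`, the tilted-kernel
  expectation of `φ(U_p)` over the four links of `p` is `⟨φ⟩₁(β) + O(β⁴)` with an explicit `η`-independent constant (part 4a's termwise
  estimate summed over the `2ⁿ` subsets of neighbours, the ratio estimate, the `|β| ≤ 1` book-keeping).
* ★★★ `exists_forall_abs_integral_plaquette_sub_onePlaquette_le`: there is `K` such that for EVERY `β ∈ ℝ` and EVERY DLR state
  `ν ∈ 𝒢(β)`, `|∫ φ(U_p) dν − ⟨φ⟩₁(β)| ≤ K β⁴` (DLR at the four links; trivial bound for `|β| > 1`); ★★★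
  `exists_forall_abs_plaquetteObs_sub_onePlaquette_le`: the mean plaquette of every DLR state of every lattice gauge theory follows the
  one-link ("Bessel") law through THIRD order — e.g. `SU(2)`: `u = I₂(β_W)/I₁(β_W) + O(β_W⁴) = β_W/4 − β_W³/96 + O(β_W⁴)`
  (Balian–Drouffe–Itzykson), for every DLR state; likewise `U(1)`, `ℤ_n`, `SU(N)`, `SO(N)`, finite groups, … .
* ★★ `exists_forall_abs_deriv_freeEnergyDensity_add_onePlaquette_le` (every `G`, `|β| < betaOne d ρ / 4`):
  `|f'(β) + #planes · (N − ⟨Re tr ρ⟩₁(β))| ≤ K β⁴` — to third order the free energy density of `ℤ^d` is `#planes` copies of the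
  one-plaquette (two-dimensional) one (gen 13's analytic torus-limit selection, gen 9's energy-subgradient chord).

References (mechanism): R. Balian, J.-M. Drouffe, C. Itzykson, PRD 11 (1975) 2104 §III; H.-O. Georgii, *Gibbs Measures and Phase
Transitions* (2011) Rem. 1.24; S. Friedli, Y. Velenik, *Statistical Mechanics of Lattice Systems* (2017) Prop. 6.91.
-/

noncomputable section

open MeasureTheory ProbabilityTheory Set Filter Topology Finset
open scoped NNReal
open Literature.Probability.LatticeModels (glueWith IsGibbsMeasure IsSpecification measurable_glueWith)
open Literature.MathematicalPhysics.QuantumLattice (LGConfig ZdEdge ZdPlaquette ymGibbsMeasures ymSpecification plaquetteObs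
  plaquetteEdges plaquettesTouching plaquetteHolonomyZd wilsonBoundaryAction IsCylinder continuous_plaquetteObs
  continuous_wilsonBoundaryAction integrable_of_bound exists_bound_of_continuous continuous_integral_ymSpecification
  abs_integral_ymSpecification_le)
open Literature.MathematicalPhysics.QuantumFieldTheory hiding ZdEdge
open Literature.MathematicalPhysics.QuantumFieldTheory.PlaquetteLowerBound (reTr continuous_reTr)

namespace Summit.Ventures.YMGap.ZeroCouplingSlope

section Kernel

variable {d N : ℕ} {G : Type*} [Group G] [TopologicalSpace G] [IsTopologicalGroup G] [CompactSpace G]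
  [MeasurableSpace G] [BorelSpace G] [SecondCountableTopology G] (ρ : G →* Matrix (Fin N) (Fin N) ℂ)

/-- Local notation: the un-tilted kernel measure of `Λ` with boundary condition `η`. -/
local notation3 (prettyPrint := false) "π⟦" Λ ", " η "⟧" =>
  ((Measure.pi fun _ : ↥(Λ : Finset (ZdEdge d)) => haarProbability G).map (glueWith Λ · (η : LGConfig d G)))

omit [TopologicalSpace G] [IsTopologicalGroup G] [CompactSpace G] [MeasurableSpace G] [BorelSpace G] [SecondCountableTopology G] in
/-- **Expansion of the boundary Boltzmann factor around the plaquette `p`.** With `T' = P(edges p) ∖ {p}` and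
`h_q = e^{−β s_q} − 1`: `e^{−β S_Λ(U)} = e^{−β s(U_p)} · Σ_{S ⊆ T'} Π_{q∈S} h_q(U)` (`Finset.prod_one_add`). [folklore] -/
theorem exp_neg_mul_wilsonBoundaryAction_eq (p : ZdPlaquette d) (β : ℝ) (U : LGConfig d G) :
    Real.exp (-β * wilsonBoundaryAction ρ (plaquetteEdges p) U) =
      Real.exp (-β * ((N : ℝ) - reTr ρ (plaquetteHolonomyZd U p.1 p.2.1.1 p.2.1.2))) *
        ∑ S ∈ ((plaquettesTouching (plaquetteEdges p)).erase p).powerset,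
          ∏ q ∈ S, (Real.exp (-β * ((N : ℝ) - plaquetteObs ρ q.1 q.2.1.1 q.2.1.2 U)) - 1) := by
  classical
  have hp : p ∈ plaquettesTouching (plaquetteEdges p) := mem_plaquettesTouching_plaquetteEdges p
  have hW : wilsonBoundaryAction ρ (plaquetteEdges p) U = ((N : ℝ) - reTr ρ (plaquetteHolonomyZd U p.1 p.2.1.1 p.2.1.2)) +
      ∑ q ∈ (plaquettesTouching (plaquetteEdges p)).erase p, ((N : ℝ) - plaquetteObs ρ q.1 q.2.1.1 q.2.1.2 U) := by
    rw [show wilsonBoundaryAction ρ (plaquetteEdges p) U =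
      ∑ q ∈ plaquettesTouching (plaquetteEdges p), ((N : ℝ) - plaquetteObs ρ q.1 q.2.1.1 q.2.1.2 U) from rfl,
      ← Finset.add_sum_erase _ _ hp]
    rfl
  have hprod : ∏ q ∈ (plaquettesTouching (plaquetteEdges p)).erase p, Real.exp (-β * ((N : ℝ) - plaquetteObs ρ q.1 q.2.1.1 q.2.1.2 U)) =
      ∑ S ∈ ((plaquettesTouching (plaquetteEdges p)).erase p).powerset,
        ∏ q ∈ S, (Real.exp (-β * ((N : ℝ) - plaquetteObs ρ q.1 q.2.1.1 q.2.1.2 U)) - 1) := by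
    rw [← Finset.prod_one_add]
    exact Finset.prod_congr rfl fun q _ => by ring
  rw [hW, mul_add, Real.exp_add, Finset.mul_sum, Real.exp_sum, hprod]

/-- **The kernel numerator as a sum over subsets of neighbours**: `E_η[φ(U_p) e^{−β S_Λ}] = Σ_{S ⊆ T'} E_η[φ e^{−βs}(U_p) Ψ_S]`. [folklore] -/
theorem integral_mul_exp_neg_mul_wilsonBoundaryAction_eq_sum (hρ : Continuous ρ) {φ : G → ℝ} (hφ : Continuous φ)
    (p : ZdPlaquette d) (η : LGConfig d G) (β : ℝ) :
    (∫ U, φ (plaquetteHolonomyZd U p.1 p.2.1.1 p.2.1.2) * Real.exp (-β * wilsonBoundaryAction ρ (plaquetteEdges p) U)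
        ∂π⟦plaquetteEdges p, η⟧) =
      ∑ S ∈ ((plaquettesTouching (plaquetteEdges p)).erase p).powerset,
        ∫ U, (φ (plaquetteHolonomyZd U p.1 p.2.1.1 p.2.1.2) *
          Real.exp (-β * ((N : ℝ) - reTr ρ (plaquetteHolonomyZd U p.1 p.2.1.1 p.2.1.2)))) *
          ∏ q ∈ S, (Real.exp (-β * ((N : ℝ) - plaquetteObs ρ q.1 q.2.1.1 q.2.1.2 U)) - 1) ∂π⟦plaquetteEdges p, η⟧ := by
  classical
  have hholc : Continuous fun U : LGConfig d G => plaquetteHolonomyZd U p.1 p.2.1.1 p.2.1.2 :=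
    AreaLaw.continuous_plaquette p.1 p.2.1.1 p.2.1.2
  have hsc : Continuous fun g : G => Real.exp (-β * ((N : ℝ) - reTr ρ g)) :=
    (continuous_const.mul (continuous_const.sub (continuous_reTr ρ hρ))).rexp
  have hΨ_c : ∀ S : Finset (ZdPlaquette d), Continuous fun U : LGConfig d G =>
      ∏ q ∈ S, (Real.exp (-β * ((N : ℝ) - plaquetteObs ρ q.1 q.2.1.1 q.2.1.2 U)) - 1) := fun S =>
    continuous_finsetProd _ fun q _ =>
      ((continuous_const.mul (continuous_const.sub (continuous_plaquetteObs ρ hρ _ _ _))).rexp).sub continuous_const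
  have e : ∀ U : LGConfig d G, φ (plaquetteHolonomyZd U p.1 p.2.1.1 p.2.1.2) *
      Real.exp (-β * wilsonBoundaryAction ρ (plaquetteEdges p) U) =
        ∑ S ∈ ((plaquettesTouching (plaquetteEdges p)).erase p).powerset, (φ (plaquetteHolonomyZd U p.1 p.2.1.1 p.2.1.2) *
          Real.exp (-β * ((N : ℝ) - reTr ρ (plaquetteHolonomyZd U p.1 p.2.1.1 p.2.1.2)))) *
          ∏ q ∈ S, (Real.exp (-β * ((N : ℝ) - plaquetteObs ρ q.1 q.2.1.1 q.2.1.2 U)) - 1) := fun U => by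
    rw [exp_neg_mul_wilsonBoundaryAction_eq ρ p β U, Finset.mul_sum, Finset.mul_sum]
    exact Finset.sum_congr rfl fun S _ => by ring
  simp_rw [e]
  exact integral_finsetSum _ fun S _ => (integrable_pi_glueWith_of_continuous _ η (((hφ.comp hholc).mul (hsc.comp hholc)).mul (hΨ_c S)) :
    Integrable (fun U : LGConfig d G => (φ (plaquetteHolonomyZd U p.1 p.2.1.1 p.2.1.2) *
      Real.exp (-β * ((N : ℝ) - reTr ρ (plaquetteHolonomyZd U p.1 p.2.1.1 p.2.1.2)))) *
      ∏ q ∈ S, (Real.exp (-β * ((N : ℝ) - plaquetteObs ρ q.1 q.2.1.1 q.2.1.2 U)) - 1)) _)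

/-- **The kernel partition function as a sum over subsets of neighbours**: `E_η[e^{−β S_Λ}] = Σ_{S ⊆ T'} E_η[e^{−βs}(U_p) Ψ_S]`. [folklore] -/
theorem integral_exp_neg_mul_wilsonBoundaryAction_eq_sum (hρ : Continuous ρ) (p : ZdPlaquette d) (η : LGConfig d G) (β : ℝ) :
    (∫ U, Real.exp (-β * wilsonBoundaryAction ρ (plaquetteEdges p) U) ∂π⟦plaquetteEdges p, η⟧) =
      ∑ S ∈ ((plaquettesTouching (plaquetteEdges p)).erase p).powerset,
        ∫ U, Real.exp (-β * ((N : ℝ) - reTr ρ (plaquetteHolonomyZd U p.1 p.2.1.1 p.2.1.2))) *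
          ∏ q ∈ S, (Real.exp (-β * ((N : ℝ) - plaquetteObs ρ q.1 q.2.1.1 q.2.1.2 U)) - 1) ∂π⟦plaquetteEdges p, η⟧ := by
  have h := integral_mul_exp_neg_mul_wilsonBoundaryAction_eq_sum ρ hρ (φ := fun _ => (1 : ℝ)) continuous_const p η β
  simpa only [one_mul] using h

omit [SecondCountableTopology G] in
/-- **The tilted kernel expectation as a ratio**: `∫ φ(U_p) dγ_η = E_η[φ(U_p) e^{−βS_Λ}] / E_η[e^{−βS_Λ}]`. [folklore] -/
theorem integral_tilted_plaquette_eq_div (φ : G → ℝ) (p : ZdPlaquette d) (η : LGConfig d G) (β : ℝ) :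
    (∫ U, φ (plaquetteHolonomyZd U p.1 p.2.1.1 p.2.1.2)
        ∂(π⟦plaquetteEdges p, η⟧.tilted fun U => -β * wilsonBoundaryAction ρ (plaquetteEdges p) U)) =
      (∫ U, φ (plaquetteHolonomyZd U p.1 p.2.1.1 p.2.1.2) * Real.exp (-β * wilsonBoundaryAction ρ (plaquetteEdges p) U)
          ∂π⟦plaquetteEdges p, η⟧) /
        ∫ U, Real.exp (-β * wilsonBoundaryAction ρ (plaquetteEdges p) U) ∂π⟦plaquetteEdges p, η⟧ := by
  rw [integral_tilted]
  simp only [smul_eq_mul]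
  have e : ∀ U : LGConfig d G, Real.exp (-β * wilsonBoundaryAction ρ (plaquetteEdges p) U) /
      (∫ V, Real.exp (-β * wilsonBoundaryAction ρ (plaquetteEdges p) V) ∂π⟦plaquetteEdges p, η⟧) *
        φ (plaquetteHolonomyZd U p.1 p.2.1.1 p.2.1.2) =
      (∫ V, Real.exp (-β * wilsonBoundaryAction ρ (plaquetteEdges p) V) ∂π⟦plaquetteEdges p, η⟧)⁻¹ *
        (φ (plaquetteHolonomyZd U p.1 p.2.1.1 p.2.1.2) * Real.exp (-β * wilsonBoundaryAction ρ (plaquetteEdges p) U)) :=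
    fun U => by ring
  simp_rw [e]
  rw [integral_const_mul, inv_mul_eq_div]

/-- **Two-sided bound on the kernel partition function**: `e^{−|β| b #T} ≤ E_η[e^{−β S_Λ}] ≤ e^{|β| b #T}` (`b = N + M`,
`#T = #P(edges p)`; part 1's `|S_Λ| ≤ b #T`). [folklore] -/
theorem integral_exp_neg_mul_wilsonBoundaryAction_mem_Icc (hρ : Continuous ρ) {M : ℝ} (hM : ∀ g : G, |(ρ g).trace.re| ≤ M)
    (p : ZdPlaquette d) (η : LGConfig d G) (β : ℝ) :
    (∫ U, Real.exp (-β * wilsonBoundaryAction ρ (plaquetteEdges p) U) ∂π⟦plaquetteEdges p, η⟧) ∈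
      Icc (Real.exp (-(|β| * (((N : ℝ) + M) * (plaquettesTouching (plaquetteEdges p)).card))))
        (Real.exp (|β| * (((N : ℝ) + M) * (plaquettesTouching (plaquetteEdges p)).card))) := by
  haveI hπP : IsProbabilityMeasure π⟦plaquetteEdges p, η⟧ := isProbabilityMeasure_pi_glueWith _ η
  have hWc : Continuous fun U : LGConfig d G => Real.exp (-β * wilsonBoundaryAction ρ (plaquetteEdges p) U) :=
    (continuous_const.mul (continuous_wilsonBoundaryAction ρ hρ _)).rexp
  have hWi := integrable_pi_glueWith_of_continuous (plaquetteEdges p) η hWc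
  have hWB : ∀ U : LGConfig d G, |β * wilsonBoundaryAction ρ (plaquetteEdges p) U| ≤
      |β| * (((N : ℝ) + M) * (plaquettesTouching (plaquetteEdges p)).card) := fun U => by
    rw [abs_mul]; exact mul_le_mul_of_nonneg_left (abs_wilsonBoundaryAction_le_card ρ hM _ U) (abs_nonneg _)
  constructor
  · calc Real.exp (-(|β| * (((N : ℝ) + M) * (plaquettesTouching (plaquetteEdges p)).card)))
        = ∫ _U, Real.exp (-(|β| * (((N : ℝ) + M) * (plaquettesTouching (plaquetteEdges p)).card))) ∂π⟦plaquetteEdges p, η⟧ := by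
          rw [integral_const, probReal_univ, one_smul]
      _ ≤ _ := integral_mono (integrable_const _) hWi fun U => by
          apply Real.exp_le_exp.2
          have h1 := hWB U; rw [abs_le] at h1
          linarith [h1.2]
  · calc (∫ U, Real.exp (-β * wilsonBoundaryAction ρ (plaquetteEdges p) U) ∂π⟦plaquetteEdges p, η⟧)
        ≤ ∫ _U, Real.exp (|β| * (((N : ℝ) + M) * (plaquettesTouching (plaquetteEdges p)).card)) ∂π⟦plaquetteEdges p, η⟧ :=
          integral_mono hWi (integrable_const _) fun U => by
            apply Real.exp_le_exp.2
            have h1 := hWB U; rw [abs_le] at h1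
            linarith [h1.1]
      _ = _ := by rw [integral_const, probReal_univ, one_smul]

/-- ★★ **The kernel estimate.** For continuous `ρ` (`|Re tr ρ| ≤ M`), continuous `φ` (`|φ| ≤ C`), a plaquette `p`, EVERY boundary condition
`η` and every `|β| ≤ 1`: the tilted-kernel expectation of `φ(U_p)` differs from the one-plaquette tilted Haar mean `⟨φ⟩₁(β)` by at most
`K₁ β⁴`, `K₁` explicit in `C`, `N + M` and `#P(edges p)`. [folklore] -/
theorem abs_integral_tilted_sub_onePlaquette_le (hρ : Continuous ρ) {M : ℝ} (hM : ∀ g : G, |(ρ g).trace.re| ≤ M) {φ : G → ℝ}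
    (hφ : Continuous φ) {C : ℝ} (hC : ∀ g, |φ g| ≤ C) (p : ZdPlaquette d) (η : LGConfig d G) {β : ℝ} (hβ : |β| ≤ 1) :
    |(∫ U, φ (plaquetteHolonomyZd U p.1 p.2.1.1 p.2.1.2)
          ∂(π⟦plaquetteEdges p, η⟧.tilted fun U => -β * wilsonBoundaryAction ρ (plaquetteEdges p) U)) -
        (∫ g, φ g * Real.exp (-β * ((N : ℝ) - reTr ρ g)) ∂haarProbability G) /
          ∫ g, Real.exp (-β * ((N : ℝ) - reTr ρ g)) ∂haarProbability G| ≤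
      2 ^ ((plaquettesTouching (plaquetteEdges p)).card - 1 + 1) * C *
        (Real.exp ((N : ℝ) + M) * Real.exp (((N : ℝ) + M) * (plaquettesTouching (plaquetteEdges p)).card)) *
        ((((N : ℝ) + M) * Real.exp ((N : ℝ) + M)) ^ 4 *
          (1 + ((N : ℝ) + M) * Real.exp ((N : ℝ) + M)) ^ ((plaquettesTouching (plaquetteEdges p)).card - 1)) * β ^ 4 := by
  classical
  have hp : p ∈ plaquettesTouching (plaquetteEdges p) := mem_plaquettesTouching_plaquetteEdges p
  set T : Finset (ZdPlaquette d) := plaquettesTouching (plaquetteEdges p) with hT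
  set n : ℕ := T.card - 1 with hn
  set b : ℝ := (N : ℝ) + M with hb
  set z : ℝ := ∫ g, Real.exp (-β * ((N : ℝ) - reTr ρ g)) ∂haarProbability G with hz
  set a : ℝ := ∫ g, φ g * Real.exp (-β * ((N : ℝ) - reTr ρ g)) ∂haarProbability G with ha
  have hM0 : 0 ≤ M := (abs_nonneg _).trans (hM 1)
  have hb0 : 0 ≤ b := by simp only [hb]; exact add_nonneg (Nat.cast_nonneg N) hM0
  have hC0 : 0 ≤ C := (abs_nonneg _).trans (hC 1)
  have hsc : Continuous fun g : G => Real.exp (-β * ((N : ℝ) - reTr ρ g)) :=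
    (continuous_const.mul (continuous_const.sub (continuous_reTr ρ hρ))).rexp
  have hz_pos : 0 < z := by
    simp only [hz]
    exact integral_exp_pos (hsc.integrable_of_hasCompactSupport (HasCompactSupport.of_compactSpace _))
  -- the tilted expectation as the ratio `A / Z`, both sums over `S`
  set A : ℝ := ∫ U, φ (plaquetteHolonomyZd U p.1 p.2.1.1 p.2.1.2) *
    Real.exp (-β * wilsonBoundaryAction ρ (plaquetteEdges p) U) ∂π⟦plaquetteEdges p, η⟧ with hA
  set Z : ℝ := ∫ U, Real.exp (-β * wilsonBoundaryAction ρ (plaquetteEdges p) U) ∂π⟦plaquetteEdges p, η⟧ with hZ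
  have hZ_lb : Real.exp (-(|β| * (b * T.card))) ≤ Z := (integral_exp_neg_mul_wilsonBoundaryAction_mem_Icc ρ hρ hM p η β).1
  have hZ_pos : 0 < Z := lt_of_lt_of_le (Real.exp_pos _) hZ_lb
  have htilt := integral_tilted_plaquette_eq_div ρ φ p η β
  have hA_sum := integral_mul_exp_neg_mul_wilsonBoundaryAction_eq_sum ρ hρ hφ p η β
  have hZ_sum := integral_exp_neg_mul_wilsonBoundaryAction_eq_sum ρ hρ p η β
  -- sum the termwise estimate over `S`
  have hAz : |A * z - a * Z| ≤ z * ((2 : ℝ) ^ n * (2 * C * Real.exp (|β| * b) *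
      ((Real.exp (|β| * b) - 1) ^ 4 * (1 + (Real.exp (|β| * b) - 1)) ^ n))) := by
    rw [hA, hZ, hA_sum, hZ_sum, Finset.sum_mul, Finset.mul_sum, ← Finset.sum_sub_distrib]
    refine (Finset.abs_sum_le_sum_abs _ _).trans ?_
    refine (Finset.sum_le_card_nsmul (T.erase p).powerset _ (2 * C * z * Real.exp (|β| * b) *
      ((Real.exp (|β| * b) - 1) ^ 4 * (1 + (Real.exp (|β| * b) - 1)) ^ n)) fun S hS => ?_).trans ?_
    · exact abs_term_sub_term_le ρ hρ hM hφ hC p η β (Finset.mem_powerset.1 hS)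
    · rw [Finset.card_powerset, nsmul_eq_mul, show (T.erase p).card = n by rw [Finset.card_erase_of_mem hp]]
      push_cast; exact le_of_eq (by ring)
  have hR0 : 0 ≤ (2 : ℝ) ^ n * (2 * C * Real.exp (|β| * b) *
      ((Real.exp (|β| * b) - 1) ^ 4 * (1 + (Real.exp (|β| * b) - 1)) ^ n)) := by
    have ht0 : 0 ≤ Real.exp (|β| * b) - 1 := by linarith [Real.one_le_exp (mul_nonneg (abs_nonneg β) hb0)]
    exact mul_nonneg (pow_nonneg (by norm_num) n) (mul_nonneg (mul_nonneg (mul_nonneg (by norm_num) hC0) (Real.exp_pos _).le)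
      (mul_nonneg (pow_nonneg ht0 4) (pow_nonneg (by linarith) n)))
  rw [htilt]
  refine (abs_div_sub_div_le_of_abs_sub_le hZ_pos hz_pos hAz hZ_lb hR0).trans ?_
  refine (kernelBound_le_of_abs_le_one (T.card : ℝ) n hβ hb0 hC0 (Nat.cast_nonneg _)).trans (le_of_eq ?_)
  rfl

end Kernel

/-! ## 3. The one-plaquette law for every DLR state -/

section DLR

variable {d N : ℕ} {G : Type*} [Group G] [TopologicalSpace G] [IsTopologicalGroup G] [CompactSpace G]
  [MeasurableSpace G] [BorelSpace G] [SecondCountableTopology G] [T2Space G] (ρ : G →* Matrix (Fin N) (Fin N) ℂ)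

/-- Local notation: the un-tilted kernel measure of `Λ` with boundary condition `η`. -/
local notation3 (prettyPrint := false) "π⟦" Λ ", " η "⟧" =>
  ((Measure.pi fun _ : ↥(Λ : Finset (ZdEdge d)) => haarProbability G).map (glueWith Λ · (η : LGConfig d G)))

/-- ★★★ **THE ONE-PLAQUETTE LAW — every compact gauge group, every DLR state, every coupling.** For continuous `ρ` and `φ`
and a plaquette `p` there is `K` such that for EVERY `β ∈ ℝ` and EVERY `ν ∈ 𝒢(β)`:
`|∫ φ(U_p) dν − ∫ φ e^{−β(N − Re tr ρ)} dHaar / ∫ e^{−β(N − Re tr ρ)} dHaar| ≤ K β⁴` — the expectation of any single-plaquette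
observable in any DLR state agrees with the ONE-PLAQUETTE tilted Haar mean through third order in `β`, uniformly over all DLR states
(DLR at the four links of `p` + the kernel estimate for `|β| ≤ 1`; the trivial bound `2C ≤ 2C β⁴` for `|β| > 1`). [folklore] -/
theorem exists_forall_abs_integral_plaquette_sub_onePlaquette_le (hρ : Continuous ρ) {φ : G → ℝ} (hφ : Continuous φ)
    (p : ZdPlaquette d) :
    ∃ K : ℝ, ∀ (β : ℝ) (ν : Measure (LGConfig d G)), ν ∈ ymGibbsMeasures (d := d) ρ β →
      |(∫ U, φ (plaquetteHolonomyZd U p.1 p.2.1.1 p.2.1.2) ∂ν) -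
          (∫ g, φ g * Real.exp (-β * ((N : ℝ) - reTr ρ g)) ∂haarProbability G) /
            ∫ g, Real.exp (-β * ((N : ℝ) - reTr ρ g)) ∂haarProbability G| ≤ K * β ^ 4 := by
  classical
  obtain ⟨M, hM0, hM⟩ := exists_bound_trace_re_nonneg ρ hρ
  obtain ⟨C, hC⟩ := exists_bound_of_continuous hφ
  have hC0 : 0 ≤ C := (abs_nonneg _).trans (hC 1)
  set K₁ : ℝ := 2 ^ ((plaquettesTouching (plaquetteEdges p)).card - 1 + 1) * C *
    (Real.exp ((N : ℝ) + M) * Real.exp (((N : ℝ) + M) * (plaquettesTouching (plaquetteEdges p)).card)) *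
    ((((N : ℝ) + M) * Real.exp ((N : ℝ) + M)) ^ 4 *
      (1 + ((N : ℝ) + M) * Real.exp ((N : ℝ) + M)) ^ ((plaquettesTouching (plaquetteEdges p)).card - 1)) with hK₁
  refine ⟨max K₁ (2 * C), fun β ν hν => ?_⟩
  have hFc : Continuous fun U : LGConfig d G => φ (plaquetteHolonomyZd U p.1 p.2.1.1 p.2.1.2) :=
    hφ.comp (AreaLaw.continuous_plaquette p.1 p.2.1.1 p.2.1.2)
  have hFC : ∀ U : LGConfig d G, |φ (plaquetteHolonomyZd U p.1 p.2.1.1 p.2.1.2)| ≤ C := fun U => hC _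
  have hνG : IsGibbsMeasure (ymSpecification (d := d) ρ β) ν := hν
  haveI : IsProbabilityMeasure ν := hνG.isProbabilityMeasure
  -- the one-plaquette mean is bounded by `C`
  have hsc : Continuous fun g : G => Real.exp (-β * ((N : ℝ) - reTr ρ g)) :=
    (continuous_const.mul (continuous_const.sub (continuous_reTr ρ hρ))).rexp
  have hzint : Integrable (fun g : G => Real.exp (-β * ((N : ℝ) - reTr ρ g))) (haarProbability G) :=
    hsc.integrable_of_hasCompactSupport (HasCompactSupport.of_compactSpace _)
  have hz : 0 < ∫ g, Real.exp (-β * ((N : ℝ) - reTr ρ g)) ∂haarProbability G := integral_exp_pos hzint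
  have hm : |(∫ g, φ g * Real.exp (-β * ((N : ℝ) - reTr ρ g)) ∂haarProbability G) /
      ∫ g, Real.exp (-β * ((N : ℝ) - reTr ρ g)) ∂haarProbability G| ≤ C := by
    rw [abs_div, abs_of_pos hz, div_le_iff₀ hz]
    calc |∫ g, φ g * Real.exp (-β * ((N : ℝ) - reTr ρ g)) ∂haarProbability G|
        ≤ ∫ g, |φ g * Real.exp (-β * ((N : ℝ) - reTr ρ g))| ∂haarProbability G := abs_integral_le_integral_abs
      _ ≤ ∫ g, C * Real.exp (-β * ((N : ℝ) - reTr ρ g)) ∂haarProbability G := by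
          refine integral_mono_of_nonneg (ae_of_all _ fun g => abs_nonneg _) (hzint.const_mul C) (ae_of_all _ fun g => ?_)
          dsimp only
          rw [abs_mul, Real.abs_exp]
          exact mul_le_mul_of_nonneg_right (hC g) (Real.exp_pos _).le
      _ = C * ∫ g, Real.exp (-β * ((N : ℝ) - reTr ρ g)) ∂haarProbability G := integral_const_mul _ _
  by_cases hβ : |β| ≤ 1
  · -- DLR at the four links and the kernel estimate
    have hγ : IsSpecification (ymSpecification (d := d) ρ β) := isSpecification_ymSpecification_of_t2Space ρ hρ β
    have hDLR : ∫ η, (∫ U, φ (plaquetteHolonomyZd U p.1 p.2.1.1 p.2.1.2) ∂(ymSpecification ρ β (plaquetteEdges p) η)) ∂ν =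
        ∫ U, φ (plaquetteHolonomyZd U p.1 p.2.1.1 p.2.1.2) ∂ν := by
      simpa only [Measure.restrict_univ] using
        hνG.setIntegral_integral_spec hγ (plaquetteEdges p) (B := Set.univ) MeasurableSet.univ hFc.measurable hFC
    have hint : Integrable (fun η => ∫ U, φ (plaquetteHolonomyZd U p.1 p.2.1.1 p.2.1.2)
        ∂(ymSpecification ρ β (plaquetteEdges p) η)) ν :=
      integrable_of_bound (continuous_integral_ymSpecification ρ hρ β _ hFc hFC).aestronglyMeasurable
        (abs_integral_ymSpecification_le ρ hρ β _ hFC)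
    have hker : ∀ η : LGConfig d G, |(∫ U, φ (plaquetteHolonomyZd U p.1 p.2.1.1 p.2.1.2)
        ∂(ymSpecification ρ β (plaquetteEdges p) η)) - (∫ g, φ g * Real.exp (-β * ((N : ℝ) - reTr ρ g)) ∂haarProbability G) /
          ∫ g, Real.exp (-β * ((N : ℝ) - reTr ρ g)) ∂haarProbability G| ≤ K₁ * β ^ 4 := fun η => by
      have h := abs_integral_tilted_sub_onePlaquette_le ρ hρ hM hφ hC p η hβ
      rw [hK₁]; exact h
    rw [← hDLR, show (∫ η, (∫ U, φ (plaquetteHolonomyZd U p.1 p.2.1.1 p.2.1.2) ∂(ymSpecification ρ β (plaquetteEdges p) η)) ∂ν) -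
        (∫ g, φ g * Real.exp (-β * ((N : ℝ) - reTr ρ g)) ∂haarProbability G) /
          ∫ g, Real.exp (-β * ((N : ℝ) - reTr ρ g)) ∂haarProbability G =
        ∫ η, ((∫ U, φ (plaquetteHolonomyZd U p.1 p.2.1.1 p.2.1.2) ∂(ymSpecification ρ β (plaquetteEdges p) η)) -
          (∫ g, φ g * Real.exp (-β * ((N : ℝ) - reTr ρ g)) ∂haarProbability G) /
            ∫ g, Real.exp (-β * ((N : ℝ) - reTr ρ g)) ∂haarProbability G) ∂ν by
      rw [integral_sub hint (integrable_const _), integral_const, probReal_univ, one_smul]]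
    have h := norm_integral_le_of_norm_le_const (μ := ν) (f := fun η => (∫ U, φ (plaquetteHolonomyZd U p.1 p.2.1.1 p.2.1.2)
        ∂(ymSpecification ρ β (plaquetteEdges p) η)) - (∫ g, φ g * Real.exp (-β * ((N : ℝ) - reTr ρ g)) ∂haarProbability G) /
          ∫ g, Real.exp (-β * ((N : ℝ) - reTr ρ g)) ∂haarProbability G) (ae_of_all _ fun η => by
        simpa only [Real.norm_eq_abs] using hker η)
    rw [probReal_univ, mul_one, Real.norm_eq_abs] at h
    exact h.trans (mul_le_mul_of_nonneg_right (le_max_left _ _) (by positivity))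
  · -- `|β| > 1`: the trivial bound
    push Not at hβ
    have hβ4 : (1 : ℝ) ≤ β ^ 4 := by
      rw [show β ^ 4 = |β| ^ 4 from (Even.pow_abs (by decide) β).symm]; exact one_le_pow₀ hβ.le
    have hν1 : |∫ U, φ (plaquetteHolonomyZd U p.1 p.2.1.1 p.2.1.2) ∂ν| ≤ C := by
      have h := norm_integral_le_of_norm_le_const (μ := ν) (f := fun U => φ (plaquetteHolonomyZd U p.1 p.2.1.1 p.2.1.2))
        (C := C) (ae_of_all _ fun U => by simpa only [Real.norm_eq_abs] using hFC U)
      rw [probReal_univ, mul_one] at h; simpa only [Real.norm_eq_abs] using h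
    calc _ ≤ |∫ U, φ (plaquetteHolonomyZd U p.1 p.2.1.1 p.2.1.2) ∂ν| + |(∫ g, φ g * Real.exp (-β * ((N : ℝ) - reTr ρ g))
          ∂haarProbability G) / ∫ g, Real.exp (-β * ((N : ℝ) - reTr ρ g)) ∂haarProbability G| := abs_sub _ _
      _ ≤ C + C := add_le_add hν1 hm
      _ = (2 * C) * 1 := by ring
      _ ≤ max K₁ (2 * C) * β ^ 4 := mul_le_mul (le_max_right _ _) hβ4 zero_le_one (le_trans (by linarith) (le_max_right _ _))

/-- ★★★ **The mean plaquette of every DLR state of every lattice gauge theory follows the one-link ("Bessel") law through third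
order**: `|∫ Re tr ρ(U_p) dν − ⟨Re tr ρ⟩₁(β)| ≤ K β⁴` for EVERY `β` and EVERY `ν ∈ 𝒢(β)` (e.g. `SU(2)` in Wilson's normalisation
`u = I₂(β_W)/I₁(β_W) + O(β_W⁴) = β_W/4 − β_W³/96 + O(β_W⁴)` — the Balian–Drouffe–Itzykson coefficients — for every DLR state). [folklore] -/
theorem exists_forall_abs_plaquetteObs_sub_onePlaquette_le (hρ : Continuous ρ) (p : ZdPlaquette d) :
    ∃ K : ℝ, ∀ (β : ℝ) (ν : Measure (LGConfig d G)), ν ∈ ymGibbsMeasures (d := d) ρ β →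
      |(∫ U, plaquetteObs ρ p.1 p.2.1.1 p.2.1.2 U ∂ν) -
          (∫ g, reTr ρ g * Real.exp (-β * ((N : ℝ) - reTr ρ g)) ∂haarProbability G) /
            ∫ g, Real.exp (-β * ((N : ℝ) - reTr ρ g)) ∂haarProbability G| ≤ K * β ^ 4 :=
  exists_forall_abs_integral_plaquette_sub_onePlaquette_le ρ hρ (continuous_reTr ρ hρ) p

end DLR

/-! ## 4. Consequence for the pressure: `f'(β) = −#planes · ⟨N − Re tr ρ⟩₁(β) + O(β⁴)`, every compact gauge group -/

section Pressure

-- `G : Type` (universe `0`): gen 9's `PressureRegularity.hasDerivAt_freeEnergyDensity` is applied below.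
variable {d' N' : ℕ} {G' : Type} [Group G'] [TopologicalSpace G'] [IsTopologicalGroup G'] [CompactSpace G']
  [MeasurableSpace G'] [BorelSpace G'] [SecondCountableTopology G'] [T2Space G'] (ρ' : G' →* Matrix (Fin N') (Fin N') ℂ)

/-- Local shorthand: the coordinate planes `{(i, j) : i < j}` of `ℤ^d`. -/
local notation3 (prettyPrint := false) "𝔓" d => {q : Fin d × Fin d // q.1 < q.2}

/-- ★★ **The energy density of the torus-limit state — hence `f'` — follows the one-plaquette law through third order, EVERY compact
gauge group**: there is `K` with `|f'(β) + #planes · (N − ⟨Re tr ρ⟩₁(β))| ≤ K β⁴` for all `|β| < betaOne d ρ / 4` (`f' = −e(ν_β)` along gen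
13's analytic torus-limit DLR selection by gen 9's energy-subgradient chord, and the one-plaquette law plane by plane). Equivalently
`f'(β) = #planes · (d/dβ) log ∫ e^{−β(N − Re tr ρ)} dHaar + O(β⁴)`: to this order the free energy density of `ℤ^d` is `#planes` copies of the
two-dimensional (one-plaquette) one. [folklore] -/
theorem exists_forall_abs_deriv_freeEnergyDensity_add_onePlaquette_le (hρ : Continuous ρ') :
    ∃ K : ℝ, ∀ β : ℝ, |β| < betaOne d' ρ' / 4 →
      |deriv (Literature.MathematicalPhysics.QuantumLattice.freeEnergyDensity d' ρ') β + (Fintype.card (𝔓 d') : ℝ) * ((N' : ℝ) -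
          (∫ g, reTr ρ' g * Real.exp (-β * ((N' : ℝ) - reTr ρ' g)) ∂haarProbability G') /
            ∫ g, Real.exp (-β * ((N' : ℝ) - reTr ρ' g)) ∂haarProbability G')| ≤ K * β ^ 4 := by
  classical
  obtain ⟨ν, hν, han⟩ := StrongCouplingAnalytic.exists_analytic_dlr_selection (d := d') ρ' hρ
  obtain ⟨M, -, hM⟩ := exists_bound_trace_re_nonneg ρ' hρ
  choose K hK using fun q : 𝔓 d' =>
    exists_forall_abs_plaquetteObs_sub_onePlaquette_le (d := d') ρ' hρ ((0 : Literature.Probability.LatticeModels.Site d'), q)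
  refine ⟨∑ q : 𝔓 d', K q, fun β hβ => ?_⟩
  have hβ' : β ∈ Ioo (-(betaOne d' ρ' / 4)) (betaOne d' ρ' / 4) := ⟨(abs_lt.1 hβ).1, (abs_lt.1 hβ).2⟩
  -- `f' = −e(ν_β)` along the selection
  have hd : HasDerivAt (Literature.MathematicalPhysics.QuantumLattice.freeEnergyDensity d' ρ')
      (-∑ q : 𝔓 d', ((N' : ℝ) - ∫ U, plaquetteObs ρ' 0 q.1.1 q.1.2 U ∂(ν β))) β := by
    refine PressureRegularity.hasDerivAt_freeEnergyDensity ρ' hρ (S := Ioo (-(betaOne d' ρ' / 4)) (betaOne d' ρ' / 4))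
      (μ := ν) (fun b hb => (hν b (abs_lt.2 ⟨hb.1, hb.2⟩)).1)
      (fun b hb => Literature.MathematicalPhysics.QuantumLattice.isZdTranslationInvariant_of_mem_infiniteVolumeLimitPoints ρ'
        (hν b (abs_lt.2 ⟨hb.1, hb.2⟩)).2.mem_infiniteVolumeLimitPoints)
      (isOpen_Ioo.mem_nhds hβ') fun q => ?_
    have hbd : ∃ C, ∀ U : LGConfig d' G', |plaquetteObs ρ' 0 q.1.1 q.1.2 U| ≤ C :=
      ⟨M, fun U => hM (plaquetteHolonomyZd U 0 q.1.1 q.1.2)⟩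
    exact (han (plaquetteObs ρ' 0 q.1.1 q.1.2) _
      (Literature.MathematicalPhysics.QuantumLattice.isCylinder_plaquetteObs_zero ρ' q.1.1 q.1.2)
      (continuous_plaquetteObs ρ' hρ 0 _ _) hbd β hβ').continuousAt
  rw [hd.deriv]
  set m : ℝ := (∫ g, reTr ρ' g * Real.exp (-β * ((N' : ℝ) - reTr ρ' g)) ∂haarProbability G') /
    ∫ g, Real.exp (-β * ((N' : ℝ) - reTr ρ' g)) ∂haarProbability G' with hm
  have e : -∑ q : 𝔓 d', ((N' : ℝ) - ∫ U, plaquetteObs ρ' 0 q.1.1 q.1.2 U ∂(ν β)) + (Fintype.card (𝔓 d') : ℝ) * ((N' : ℝ) - m) =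
      ∑ q : 𝔓 d', ((∫ U, plaquetteObs ρ' 0 q.1.1 q.1.2 U ∂(ν β)) - m) := by
    rw [← Finset.card_univ, ← nsmul_eq_mul, ← Finset.sum_const, ← Finset.sum_neg_distrib, ← Finset.sum_add_distrib]
    exact Finset.sum_congr rfl fun q _ => by ring
  rw [e, Finset.sum_mul]
  refine (Finset.abs_sum_le_sum_abs _ _).trans (Finset.sum_le_sum fun q _ => ?_)
  exact hK q β (ν β) (hν β hβ).1

end Pressure

end Summit.Ventures.YMGap.ZeroCouplingSlope
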